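import Literature.NumberTheory.Sieve.Maynard2016Lemma7ProbModel

/-!
# Maynard (2016), Lemma 7 — exact independence in the finite model and the class bound

J. Maynard, *Large gaps between primes*, Ann. of Math. 183 (2016), §6, proof of Lemma 7, the
paragraph before (6.33): "we may restrict q to lie in any residue class modulo p for w < p ≤ y at
the cost of a factor ≪_k p⁻¹" — here carried out EXACTLY in the finite probability model of
`Maynard2016Lemma7ProbModel` (reduced residues `u` modulo a squarefree `R = p R'`), with no
multiplicative-function estimates: only the Chinese remainder theorem and Cauchy–Schwarz.

Fix a prime `p` and a weight `Λ` supported on vectors with squarefree coordinates.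
* `LinSys`, `XL`, `Xwt_eq_XL` — the variable `X_Λ(u)` with the one-pair system split into its
  `d`-side `d_j ∣ P_j + A_j u` and `e`-side; `PFree p d` (`p ∤ d_j ∀ j`), `scaleAt p S d`
  (multiply the coordinates in `S` by `p`), `linSys_scaleAt_iff`;
* `sum_rbox_linSys_eq_sum_powerset` — **pattern decomposition** of a one-sided sum over `rbox`
  according to the set `S` of coordinates divisible by `p`;
* `patWt`, `XL_eq_sum_patWt` — `X_Λ(u) = Σ_{S,T} [p ∣ L_j(u) ∀ j ∈ S][p ∣ M_l(u) ∀ l ∈ T] X_{Λ^{(S,T)}}(u)`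
  with the `p`-FREE pattern weights `Λ^{(S,T)}(d,e) = [p ∤ d, e][p^S d, p^T e ∈ rbox] Λ(p^S d, p^T e)`;
  `XL_sq_le_sum_patWt_sq` — Cauchy–Schwarz: `X_Λ(u)² ≤ 4^k Σ_{S,T} X_{Λ^{(S,T)}}(u)²`;
* `XL_congr_of_modEq` — a weight with moduli dividing `N` only sees `u mod N`;
  `sum_unitsR_filter_mod_eq_sum` — `Σ_{u ∈ U_{pR'}, u ≡ c (p)} F(u) = Σ_{b ∈ U_{R'}} F(b)` for
  `R'`-periodic `F` (CRT);
* `badClasses`, `card_badClasses_le` — the `≤ 2(k−1)` root classes modulo `p`; off them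
  `X_Λ = X_{Λ^{pf}}` (`XL_eq_XL_pfPart_of_good`), whence
  `sum_unitsR_XL_pfPart_sq_le` — **`((p−1)/2) Σ_{b ∈ U_{R'}} X_{Λ^{pf}}(b)² ≤ Σ_{u ∈ U_{pR'}} X_Λ(u)²`**
  for `p − 1 ≥ 4(k−1)`;
* `sum_filter_mod_XL_sq_le` — **the class bound**:
  `Σ_{u ∈ U_{pR'}, u ≡ c (p)} X_Λ(u)² ≤ (2·4^k/(p−1)) Σ_{S,T} Σ_{u ∈ U_{pR'}} X_{Λ^{[S,T]}}(u)²` with the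
  FULL pattern weights `Λ^{[S,T]}(d,e) = [p^S d, p^T e ∈ rbox] Λ(p^S d, p^T e)` (for `Λ = λ` these are
  sieve weights with the cutoffs of the slots in `S, T` shifted by `log p`), and in `Qform` terms
  `sum_filter_mod_Xwt_sq_le_totient_mul_Qform` :
  `Σ_{u ≡ c} X_Λ(u)² ≤ (2·4^k/(p−1)) φ(p R') Σ_{S,T} Q(Λ^{[S,T]}, Λ^{[S,T]})`.

## References

* J. Maynard, *Large gaps between primes*, Ann. of Math. (2) 183 (2016), 915–933; arXiv:1408.5110,
  §6, proof of Lemma 7, displays (6.27)–(6.29), (6.32)–(6.33). [Maynard2016LargeGaps]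
-/

noncomputable section

open Finset
open scoped BigOperators

namespace Literature.NumberTheory.Sieve

namespace Maynard2016

variable {k : ℕ}

/-! ### One-sided systems and the variable `X_Λ` -/

/-- A one-sided system `d_j ∣ P_j + A_j u` for all `j`. [cite: Maynard2016LargeGaps, Lemma 7 (proof, display (6.27))] -/
def LinSys (d : Fin k → ℕ) (P A : Fin k → ℤ) (u : ℕ) : Prop :=
  ∀ j, (d j : ℤ) ∣ P j + A j * (u : ℤ)

/-- The one-pair system is the conjunction of its `d`-side and its `e`-side. [cite: Maynard2016LargeGaps, Lemma 7 (proof, display (6.27))] -/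
theorem sysT_iff_linSys {x m p₀ : ℕ} {i : Fin k} (d e : Fin k → ℕ) (u : ℕ) :
    SysT k x m p₀ i d e u ↔
      LinSys d (fun j => sysP k m p₀ (Sum.inl j)) (fun j => sysA k x i m (Sum.inl j)) u ∧
        LinSys e (fun j => sysP k m p₀ (Sum.inr j)) (fun j => sysA k x i m (Sum.inr j)) u := by
  unfold SysT LinSys sysD₁
  rw [Sum.forall]
  rfl

open Classical in
/-- The variable of a weight `W` for general one-sided systems `(P_d, A_d)`, `(P_e, A_e)`:
`X(u) = Σ_{d, e ∈ rbox} [LinSys d P_d A_d u ∧ LinSys e P_e A_e u] W(d,e)`.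
[cite: Maynard2016LargeGaps, Lemma 7 (proof, display (6.32))] -/
def XL (k X : ℕ) (i : Fin k) (Pd Ad Pe Ae : Fin k → ℤ) (W : (Fin k → ℕ) → (Fin k → ℕ) → ℝ)
    (u : ℕ) : ℝ :=
  ∑ d ∈ rbox k X i, ∑ e ∈ rbox k X i, if LinSys d Pd Ad u ∧ LinSys e Pe Ae u then W d e else 0

/-- `X_Λ` of the model is `XL` for the Lemma 7 coefficients. [cite: Maynard2016LargeGaps, Lemma 7 (proof, display (6.32))] -/
theorem Xwt_eq_XL {x m p₀ : ℕ} {i : Fin k} (Λ : (Fin k → ℕ) → (Fin k → ℕ) → ℝ) (u : ℕ) :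
    Xwt k x m p₀ i Λ u =
      XL k x i (fun j => sysP k m p₀ (Sum.inl j)) (fun j => sysA k x i m (Sum.inl j))
        (fun j => sysP k m p₀ (Sum.inr j)) (fun j => sysA k x i m (Sum.inr j)) Λ u := by
  unfold Xwt XL
  refine Finset.sum_congr rfl fun d _ => Finset.sum_congr rfl fun e _ => ?_
  by_cases h : SysT k x m p₀ i d e u
  · rw [if_pos h, if_pos ((sysT_iff_linSys d e u).1 h)]
  · rw [if_neg h, if_neg (mt (sysT_iff_linSys d e u).2 h)]

/-- Transposition `d ↔ e`. [cite: Maynard2016LargeGaps, Lemma 7 (proof, display (6.32))] -/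
theorem XL_transpose {X : ℕ} {i : Fin k} (Pd Ad Pe Ae : Fin k → ℤ)
    (W : (Fin k → ℕ) → (Fin k → ℕ) → ℝ) (u : ℕ) :
    XL k X i Pd Ad Pe Ae W u = XL k X i Pe Ae Pd Ad (fun e d => W d e) u := by
  unfold XL
  rw [Finset.sum_comm]
  refine Finset.sum_congr rfl fun e _ => Finset.sum_congr rfl fun d _ => ?_
  by_cases h : LinSys d Pd Ad u ∧ LinSys e Pe Ae u
  · rw [if_pos h, if_pos h.symm]
  · rw [if_neg h, if_neg (fun h' => h h'.symm)]

/-! ### `p`-free vectors and scaling -/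

/-- `p ∤ d_j` for all `j`. [cite: Maynard2016LargeGaps, Lemma 7 (proof, before (6.33))] -/
def PFree (p : ℕ) (d : Fin k → ℕ) : Prop := ∀ j, ¬ p ∣ d j

/-- Multiply the coordinates in `S` by `p`. [cite: Maynard2016LargeGaps, Lemma 7 (proof, before (6.33))] -/
def scaleAt (p : ℕ) (S : Finset (Fin k)) (d : Fin k → ℕ) : Fin k → ℕ :=
  fun j => if j ∈ S then p * d j else d j

/-- `p n ∣ z ↔ p ∣ z ∧ n ∣ z` for a prime `p ∤ n`. [cite: Maynard2016LargeGaps, Lemma 7 (proof, before (6.33))] -/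
theorem natCast_prime_mul_dvd_iff {p n : ℕ} (hp : p.Prime) (hn : ¬ p ∣ n) (z : ℤ) :
    ((p * n : ℕ) : ℤ) ∣ z ↔ (p : ℤ) ∣ z ∧ (n : ℤ) ∣ z := by
  have hcop : Nat.Coprime p n := (Nat.Prime.coprime_iff_not_dvd hp).2 hn
  rw [← hcop.lcm_eq_mul]
  simp only [Int.natCast_dvd, Nat.lcm_dvd_iff]

/-- **Scaling splits the conditions**: for `p ∤ d`,
`LinSys (p^S d) ↔ (∀ j ∈ S, p ∣ P_j + A_j u) ∧ LinSys d`. [cite: Maynard2016LargeGaps, Lemma 7 (proof, before (6.33))] -/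
theorem linSys_scaleAt_iff {p : ℕ} (hp : p.Prime) {d : Fin k → ℕ} (hd : PFree p d)
    (S : Finset (Fin k)) (P A : Fin k → ℤ) (u : ℕ) :
    LinSys (scaleAt p S d) P A u ↔ (∀ j ∈ S, (p : ℤ) ∣ P j + A j * (u : ℤ)) ∧ LinSys d P A u := by
  constructor
  · intro h
    refine ⟨fun j hj => ?_, fun j => ?_⟩
    · have h1 := h j
      simp only [scaleAt, if_pos hj] at h1
      exact ((natCast_prime_mul_dvd_iff hp (hd j) _).1 h1).1
    · have h1 := h j
      by_cases hj : j ∈ S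
      · simp only [scaleAt, if_pos hj] at h1
        exact ((natCast_prime_mul_dvd_iff hp (hd j) _).1 h1).2
      · simpa only [scaleAt, if_neg hj] using h1
  · rintro ⟨hS, hd'⟩ j
    by_cases hj : j ∈ S
    · simp only [scaleAt, if_pos hj]
      exact (natCast_prime_mul_dvd_iff hp (hd j) _).2 ⟨hS j hj, hd' j⟩
    · simp only [scaleAt, if_neg hj]
      exact hd' j

/-- **Scaling is injective on `p`-free vectors.** [cite: Maynard2016LargeGaps, Lemma 7 (proof, before (6.33))] -/
theorem scaleAt_injective {p : ℕ} (hp : p.Prime) {S S' : Finset (Fin k)} {d d' : Fin k → ℕ}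
    (hd : PFree p d) (hd' : PFree p d') (h : scaleAt p S d = scaleAt p S' d') :
    S = S' ∧ d = d' := by
  have hj : ∀ j, scaleAt p S d j = scaleAt p S' d' j := fun j => by rw [h]
  have hmem : ∀ j, j ∈ S ↔ j ∈ S' := by
    intro j
    have h1 := hj j
    simp only [scaleAt] at h1
    constructor
    · intro hjS
      by_contra hjS'
      rw [if_pos hjS, if_neg hjS'] at h1
      exact hd' j ⟨d j, h1.symm⟩
    · intro hjS'
      by_contra hjS
      rw [if_neg hjS, if_pos hjS'] at h1
      exact hd j ⟨d' j, h1⟩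
  have hS : S = S' := Finset.ext hmem
  refine ⟨hS, funext fun j => ?_⟩
  have h1 := hj j
  simp only [scaleAt] at h1
  by_cases hjS : j ∈ S
  · rw [if_pos hjS, if_pos ((hmem j).1 hjS)] at h1
    exact Nat.eq_of_mul_eq_mul_left hp.pos h1
  · rw [if_neg hjS, if_neg (fun h' => hjS ((hmem j).2 h'))] at h1
    exact h1

/-- The coordinates divide their scalings. [cite: Maynard2016LargeGaps, Lemma 7 (proof, before (6.33))] -/
theorem dvd_scaleAt (p : ℕ) (S : Finset (Fin k)) (d : Fin k → ℕ) (j : Fin k) :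
    d j ∣ scaleAt p S d j := by
  simp only [scaleAt]
  split_ifs
  · exact Dvd.intro_left _ rfl
  · exact dvd_rfl

/-- `d_j ≤ (p^S d)_j` for `p ≥ 1`. [cite: Maynard2016LargeGaps, Lemma 7 (proof, before (6.33))] -/
theorem le_scaleAt {p : ℕ} (hp : 0 < p) (S : Finset (Fin k)) (d : Fin k → ℕ) (j : Fin k) :
    d j ≤ scaleAt p S d j := by
  simp only [scaleAt]
  split_ifs
  · exact Nat.le_mul_of_pos_left _ hp
  · exact le_rfl

/-- If `p^S d ∈ rbox` then `d ∈ rbox`. [cite: Maynard2016LargeGaps, Lemma 7 (proof, before (6.33))] -/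
theorem mem_rbox_of_scaleAt_mem {p : ℕ} (hp : 0 < p) {X : ℕ} {i : Fin k} {S : Finset (Fin k)}
    {d : Fin k → ℕ} (h : scaleAt p S d ∈ rbox k X i) : d ∈ rbox k X i := by
  rw [mem_rbox] at h ⊢
  obtain ⟨hb, hi⟩ := h
  refine ⟨Fintype.mem_piFinset.2 fun j => ?_, ?_⟩
  · have hbj := Finset.mem_Icc.1 (Fintype.mem_piFinset.1 hb j)
    refine Finset.mem_Icc.2 ⟨?_, (le_scaleAt hp S d j).trans hbj.2⟩
    rcases Nat.eq_zero_or_pos (d j) with h0 | h0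
    · exfalso
      have : scaleAt p S d j = 0 := by simp only [scaleAt, h0, mul_zero, ite_self]
      rw [this] at hbj
      exact absurd hbj.1 (by norm_num)
    · exact h0
  · have h1 := hi
    simp only [scaleAt] at h1
    split_ifs at h1 with hj
    · exact (Nat.eq_one_of_mul_eq_one_left h1)
    · exact h1

/-- **Unscaling a squarefree vector**: `d' = p^{S₀} d₀` with `d₀` `p`-free;
`d₀ ∈ rbox` if `d' ∈ rbox`. [cite: Maynard2016LargeGaps, Lemma 7 (proof, before (6.33))] -/
theorem exists_scaleAt_eq_of_squarefree {p : ℕ} (hp : p.Prime) {X : ℕ} {i : Fin k}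
    {d' : Fin k → ℕ} (hd' : d' ∈ rbox k X i) (hsq : ∀ j, Squarefree (d' j)) :
    ∃ S : Finset (Fin k), ∃ d : Fin k → ℕ, PFree p d ∧ d ∈ rbox k X i ∧ scaleAt p S d = d' := by
  classical
  refine ⟨Finset.univ.filter (fun j => p ∣ d' j), fun j => if p ∣ d' j then d' j / p else d' j,
    fun j => ?_, ?_, funext fun j => ?_⟩
  · show ¬ p ∣ (if p ∣ d' j then d' j / p else d' j)
    by_cases hj : p ∣ d' j
    · rw [if_pos hj]
      intro hdiv
      obtain ⟨q, hq⟩ := hj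
      have hq' : d' j / p = q := by rw [hq, Nat.mul_div_cancel_left _ hp.pos]
      rw [hq'] at hdiv
      obtain ⟨r, hr⟩ := hdiv
      have : p * p ∣ d' j := ⟨r, by rw [hq, hr, mul_assoc]⟩
      exact hp.one_lt.ne' (Nat.isUnit_iff.1 (hsq j p this))
    · rw [if_neg hj]; exact hj
  · rw [mem_rbox] at hd' ⊢
    obtain ⟨hb, hi⟩ := hd'
    refine ⟨Fintype.mem_piFinset.2 fun j => ?_, ?_⟩
    · have hbj := Finset.mem_Icc.1 (Fintype.mem_piFinset.1 hb j)
      by_cases hj : p ∣ d' j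
      · rw [if_pos hj, Finset.mem_Icc]
        refine ⟨?_, (Nat.div_le_self _ _).trans hbj.2⟩
        obtain ⟨q, hq⟩ := hj
        rw [hq, Nat.mul_div_cancel_left _ hp.pos]
        rcases Nat.eq_zero_or_pos q with hq0 | hq0
        · exfalso; rw [hq, hq0, mul_zero] at hbj; exact absurd hbj.1 (by norm_num)
        · exact hq0
      · rw [if_neg hj, Finset.mem_Icc]; exact hbj
    · have hndvd : ¬ p ∣ d' i := by rw [hi]; exact hp.one_lt.ne' ∘ Nat.dvd_one.1
      show (if p ∣ d' i then d' i / p else d' i) = 1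
      rw [if_neg hndvd, hi]
  · simp only [scaleAt, Finset.mem_filter, Finset.mem_univ, true_and]
    by_cases hj : p ∣ d' j
    · rw [if_pos hj, if_pos hj]
      exact Nat.mul_div_cancel' hj
    · rw [if_neg hj, if_neg hj]

/-- A product of an indicator and a restricted value. [cite: Maynard2016LargeGaps, Lemma 7 (proof, display (6.32))] -/
theorem boole_mul_ite_zero (A B : Prop) [Decidable A] [Decidable B] (c : ℝ) :
    (if A then (1 : ℝ) else 0) * (if B then c else 0) = if A ∧ B then c else 0 := by
  by_cases hA : A <;> by_cases hB : B <;> simp [hA, hB]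

open Classical in
/-- **Pattern decomposition of a one-sided sum**: for a weight `w` on `rbox` vanishing off the
vectors with squarefree coordinates and a prime `p`,
`Σ_{d ∈ rbox} [LinSys d] w(d) = Σ_{S} [∀ j ∈ S, p ∣ P_j + A_j u] Σ_{d ∈ rbox, p ∤ d, p^S d ∈ rbox} [LinSys d] w(p^S d)`
(group `d` according to the set `S` of coordinates divisible by `p`).
[cite: Maynard2016LargeGaps, Lemma 7 (proof, before (6.33))] -/
theorem sum_rbox_linSys_eq_sum_powerset {p : ℕ} (hp : p.Prime) {X : ℕ} {i : Fin k}
    (P A : Fin k → ℤ) (u : ℕ) (w : (Fin k → ℕ) → ℝ)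
    (hw : ∀ d ∈ rbox k X i, w d ≠ 0 → ∀ j, Squarefree (d j)) :
    ∑ d ∈ rbox k X i, (if LinSys d P A u then w d else 0) =
      ∑ S ∈ (Finset.univ : Finset (Fin k)).powerset,
        (if ∀ j ∈ S, (p : ℤ) ∣ P j + A j * (u : ℤ) then (1 : ℝ) else 0) *
          ∑ d ∈ rbox k X i, (if PFree p d ∧ scaleAt p S d ∈ rbox k X i ∧ LinSys d P A u then
            w (scaleAt p S d) else 0) := by
  set f : (Fin k → ℕ) → ℝ := fun d' => if LinSys d' P A u then w d' else 0 with hf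
  set dom : Finset (Finset (Fin k) × (Fin k → ℕ)) :=
    (((Finset.univ : Finset (Fin k)).powerset) ×ˢ rbox k X i).filter
      (fun Sd => PFree p Sd.2 ∧ scaleAt p Sd.1 Sd.2 ∈ rbox k X i) with hdom
  -- Step 1: the right-hand side is `Σ_{(S,d) ∈ dom} f (p^S d)`
  have hR : ∑ S ∈ (Finset.univ : Finset (Fin k)).powerset,
        (if ∀ j ∈ S, (p : ℤ) ∣ P j + A j * (u : ℤ) then (1 : ℝ) else 0) *
          ∑ d ∈ rbox k X i, (if PFree p d ∧ scaleAt p S d ∈ rbox k X i ∧ LinSys d P A u then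
            w (scaleAt p S d) else 0) = ∑ Sd ∈ dom, f (scaleAt p Sd.1 Sd.2) := by
    rw [hdom, Finset.sum_filter, Finset.sum_product]
    refine Finset.sum_congr rfl fun S _ => ?_
    rw [Finset.mul_sum]
    refine Finset.sum_congr rfl fun d _ => ?_
    simp only [hf]
    by_cases hpf : PFree p d
    · by_cases hmem : scaleAt p S d ∈ rbox k X i
      · rw [boole_mul_ite_zero, if_pos (show PFree p d ∧ scaleAt p S d ∈ rbox k X i from ⟨hpf, hmem⟩)]
        by_cases hl : LinSys (scaleAt p S d) P A u
        · rw [if_pos hl, if_pos (show (∀ j ∈ S, (p : ℤ) ∣ P j + A j * (u : ℤ)) ∧ PFree p d ∧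
            scaleAt p S d ∈ rbox k X i ∧ LinSys d P A u from
            ⟨((linSys_scaleAt_iff hp hpf S P A u).1 hl).1, hpf, hmem,
              ((linSys_scaleAt_iff hp hpf S P A u).1 hl).2⟩)]
        · rw [if_neg hl, if_neg (show ¬ ((∀ j ∈ S, (p : ℤ) ∣ P j + A j * (u : ℤ)) ∧ PFree p d ∧
            scaleAt p S d ∈ rbox k X i ∧ LinSys d P A u) from
            fun h => hl ((linSys_scaleAt_iff hp hpf S P A u).2 ⟨h.1, h.2.2.2⟩))]
      · rw [if_neg (show ¬ (PFree p d ∧ scaleAt p S d ∈ rbox k X i ∧ LinSys d P A u) from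
          fun h => hmem h.2.1), if_neg (show ¬ (PFree p d ∧ scaleAt p S d ∈ rbox k X i) from
          fun h => hmem h.2), mul_zero]
    · rw [if_neg (show ¬ (PFree p d ∧ scaleAt p S d ∈ rbox k X i ∧ LinSys d P A u) from
        fun h => hpf h.1), if_neg (show ¬ (PFree p d ∧ scaleAt p S d ∈ rbox k X i) from
        fun h => hpf h.1), mul_zero]
  rw [hR]
  -- Step 2: scaling is injective on `dom`
  have hinj : Set.InjOn (fun Sd : Finset (Fin k) × (Fin k → ℕ) => scaleAt p Sd.1 Sd.2) dom := by
    rintro ⟨S, d⟩ hSd ⟨S', d'⟩ hSd' h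
    simp only [hdom, Finset.coe_filter, Set.mem_setOf_eq] at hSd hSd'
    have h' : scaleAt p S d = scaleAt p S' d' := h
    obtain ⟨h1, h2⟩ := scaleAt_injective hp hSd.2.1 hSd'.2.1 h'
    rw [h1, h2]
  rw [← Finset.sum_image hinj]
  -- Step 3: the image misses only points where `f` vanishes
  symm
  refine Finset.sum_subset ?_ ?_
  · intro d' hd'
    obtain ⟨⟨S, d⟩, hSd, rfl⟩ := Finset.mem_image.1 hd'
    simp only [hdom, Finset.mem_filter] at hSd
    exact hSd.2.2
  · intro d' hd' hnot
    by_contra hne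
    have hw' : w d' ≠ 0 := by
      intro h0; apply hne; simp [hf, h0]
    obtain ⟨S, d, hpf, hdr, hscd⟩ := exists_scaleAt_eq_of_squarefree hp hd' (hw d' hd' hw')
    refine hnot (Finset.mem_image.2 ⟨(S, d), ?_, hscd⟩)
    simp only [hdom, Finset.mem_filter, Finset.mem_product, Finset.mem_powerset,
      Finset.subset_univ, true_and]
    exact ⟨hdr, hpf, by rw [hscd]; exact hd'⟩

/-! ### Pattern weights and the decomposition of `X_Λ` -/

open Classical in
/-- Column pattern: `(W ◃ T)(d,e) = [p ∤ e][p^T e ∈ rbox] W(d, p^T e)`. [cite: Maynard2016LargeGaps, Lemma 7 (proof, before (6.33))] -/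
def colPat (k X : ℕ) (i : Fin k) (p : ℕ) (T : Finset (Fin k))
    (W : (Fin k → ℕ) → (Fin k → ℕ) → ℝ) : (Fin k → ℕ) → (Fin k → ℕ) → ℝ :=
  fun d e => if PFree p e ∧ scaleAt p T e ∈ rbox k X i then W d (scaleAt p T e) else 0

open Classical in
/-- Row pattern: `(S ▹ W)(d,e) = [p ∤ d][p^S d ∈ rbox] W(p^S d, e)`. [cite: Maynard2016LargeGaps, Lemma 7 (proof, before (6.33))] -/
def rowPat (k X : ℕ) (i : Fin k) (p : ℕ) (S : Finset (Fin k))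
    (W : (Fin k → ℕ) → (Fin k → ℕ) → ℝ) : (Fin k → ℕ) → (Fin k → ℕ) → ℝ :=
  fun d e => if PFree p d ∧ scaleAt p S d ∈ rbox k X i then W (scaleAt p S d) e else 0

open Classical in
/-- The `p`-free pattern weight `Λ^{(S,T)}(d,e) = [p ∤ d][p^S d ∈ rbox][p ∤ e][p^T e ∈ rbox] Λ(p^S d, p^T e)`.
[cite: Maynard2016LargeGaps, Lemma 7 (proof, before (6.33))] -/
def patWt (k X : ℕ) (i : Fin k) (p : ℕ) (S T : Finset (Fin k))
    (Λ : (Fin k → ℕ) → (Fin k → ℕ) → ℝ) : (Fin k → ℕ) → (Fin k → ℕ) → ℝ :=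
  fun d e => if (PFree p d ∧ scaleAt p S d ∈ rbox k X i) ∧ (PFree p e ∧ scaleAt p T e ∈ rbox k X i)
    then Λ (scaleAt p S d) (scaleAt p T e) else 0

open Classical in
/-- The FULL pattern weight `Λ^{[S,T]}(d,e) = [p^S d ∈ rbox][p^T e ∈ rbox] Λ(p^S d, p^T e)`.
[cite: Maynard2016LargeGaps, Lemma 7 (proof, before (6.33))] -/
def fullPatWt (k X : ℕ) (i : Fin k) (p : ℕ) (S T : Finset (Fin k))
    (Λ : (Fin k → ℕ) → (Fin k → ℕ) → ℝ) : (Fin k → ℕ) → (Fin k → ℕ) → ℝ :=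
  fun d e => if scaleAt p S d ∈ rbox k X i ∧ scaleAt p T e ∈ rbox k X i then
    Λ (scaleAt p S d) (scaleAt p T e) else 0

open Classical in
/-- The `p`-free part of a weight. [cite: Maynard2016LargeGaps, Lemma 7 (proof, before (6.33))] -/
def pfPart (p : ℕ) (Λ : (Fin k → ℕ) → (Fin k → ℕ) → ℝ) : (Fin k → ℕ) → (Fin k → ℕ) → ℝ :=
  fun d e => if PFree p d ∧ PFree p e then Λ d e else 0

/-- `S ▹ (W ◃ T) = W^{(S,T)}`. [cite: Maynard2016LargeGaps, Lemma 7 (proof, before (6.33))] -/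
theorem rowPat_colPat (k X : ℕ) (i : Fin k) (p : ℕ) (S T : Finset (Fin k))
    (W : (Fin k → ℕ) → (Fin k → ℕ) → ℝ) :
    rowPat k X i p S (colPat k X i p T W) = patWt k X i p S T W := by
  funext d e
  simp only [rowPat, colPat, patWt]
  by_cases h1 : PFree p d ∧ scaleAt p S d ∈ rbox k X i <;>
    by_cases h2 : PFree p e ∧ scaleAt p T e ∈ rbox k X i <;> simp [h1, h2]

/-- `Λ^{(S,T)}` is the `p`-free part of `Λ^{[S,T]}`. [cite: Maynard2016LargeGaps, Lemma 7 (proof, before (6.33))] -/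
theorem patWt_eq_pfPart_fullPatWt (k X : ℕ) (i : Fin k) (p : ℕ) (S T : Finset (Fin k))
    (Λ : (Fin k → ℕ) → (Fin k → ℕ) → ℝ) :
    patWt k X i p S T Λ = pfPart p (fullPatWt k X i p S T Λ) := by
  funext d e
  simp only [patWt, pfPart, fullPatWt]
  by_cases h1 : PFree p d <;> by_cases h2 : PFree p e <;> simp [h1, h2]

/-- Squarefree support is inherited by the full pattern weights. [cite: Maynard2016LargeGaps, Lemma 7 (proof, before (6.33))] -/
theorem fullPatWt_sqfree {X : ℕ} {i : Fin k} {p : ℕ} (S T : Finset (Fin k))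
    {W : (Fin k → ℕ) → (Fin k → ℕ) → ℝ}
    (hW : ∀ d e, W d e ≠ 0 → (∀ j, Squarefree (d j)) ∧ ∀ j, Squarefree (e j)) :
    ∀ d e, fullPatWt k X i p S T W d e ≠ 0 → (∀ j, Squarefree (d j)) ∧ ∀ j, Squarefree (e j) := by
  intro d e h
  simp only [fullPatWt] at h
  by_cases hc : scaleAt p S d ∈ rbox k X i ∧ scaleAt p T e ∈ rbox k X i
  · rw [if_pos hc] at h
    obtain ⟨hsd, hse⟩ := hW _ _ h
    exact ⟨fun j => (hsd j).squarefree_of_dvd (dvd_scaleAt p S d j),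
      fun j => (hse j).squarefree_of_dvd (dvd_scaleAt p T e j)⟩
  · rw [if_neg hc] at h
    exact absurd rfl h

/-- Admissibility is inherited by the full pattern weights (divisors of squarefree numbers are
squarefree, `d_j ≤ p d_j`, divisors of numbers prime to `m p₀ − 1` are prime to it).
[cite: Maynard2016LargeGaps, Lemma 7 (proof, before (6.33))] -/
theorem AdmWt.fullPatWt {m p₀ X : ℕ} {i : Fin k} {p : ℕ} (hp : p.Prime)
    {Λ : (Fin k → ℕ) → (Fin k → ℕ) → ℝ} (hΛ : AdmWt k m p₀ Λ) (S T : Finset (Fin k)) :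
    AdmWt k m p₀ (fullPatWt k X i p S T Λ) := by
  intro d e h
  simp only [Maynard2016.fullPatWt] at h
  by_cases hc : scaleAt p S d ∈ rbox k X i ∧ scaleAt p T e ∈ rbox k X i
  · rw [if_pos hc] at h
    obtain ⟨hsd, hse, hdd, hce⟩ := hΛ _ _ h
    refine ⟨fun j => (hsd j).squarefree_of_dvd (dvd_scaleAt p S d j),
      fun j => (hse j).squarefree_of_dvd (dvd_scaleAt p T e j), fun j => ?_,
      fun j => (hce j).coprime_dvd_right (dvd_scaleAt p T e j)⟩
    exact lt_of_le_of_lt (Nat.mul_le_mul (le_scaleAt hp.pos S d j) (le_scaleAt hp.pos S d j))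
      (hdd j)
  · rw [if_neg hc] at h
    exact absurd rfl h

/-- Admissibility is inherited by the `p`-free part. [cite: Maynard2016LargeGaps, Lemma 7 (proof, before (6.33))] -/
theorem AdmWt.pfPart {m p₀ : ℕ} {p : ℕ} {Λ : (Fin k → ℕ) → (Fin k → ℕ) → ℝ}
    (hΛ : AdmWt k m p₀ Λ) : AdmWt k m p₀ (pfPart p Λ) := by
  intro d e h
  simp only [Maynard2016.pfPart] at h
  by_cases hc : PFree p d ∧ PFree p e
  · rw [if_pos hc] at h
    exact hΛ _ _ h
  · rw [if_neg hc] at h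
    exact absurd rfl h

open Classical in
/-- **Column decomposition**: `X_W(u) = Σ_T [∀ l ∈ T, p ∣ P^e_l + A^e_l u] X_{W ◃ T}(u)` for `W`
vanishing off squarefree `e`. [cite: Maynard2016LargeGaps, Lemma 7 (proof, before (6.33))] -/
theorem XL_eq_sum_colPat {p : ℕ} (hp : p.Prime) {X : ℕ} {i : Fin k} (Pd Ad Pe Ae : Fin k → ℤ)
    {W : (Fin k → ℕ) → (Fin k → ℕ) → ℝ} (hW : ∀ d e, W d e ≠ 0 → ∀ j, Squarefree (e j)) (u : ℕ) :
    XL k X i Pd Ad Pe Ae W u =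
      ∑ T ∈ (Finset.univ : Finset (Fin k)).powerset,
        (if ∀ j ∈ T, (p : ℤ) ∣ Pe j + Ae j * (u : ℤ) then (1 : ℝ) else 0) *
          XL k X i Pd Ad Pe Ae (colPat k X i p T W) u := by
  -- both sides as `Σ_d [Ld] * (…)`
  have hL : XL k X i Pd Ad Pe Ae W u = ∑ d ∈ rbox k X i, (if LinSys d Pd Ad u then (1 : ℝ) else 0) *
      ∑ e ∈ rbox k X i, (if LinSys e Pe Ae u then W d e else 0) := by
    unfold XL
    refine Finset.sum_congr rfl fun d _ => ?_
    rw [Finset.mul_sum]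
    refine Finset.sum_congr rfl fun e _ => ?_
    rw [boole_mul_ite_zero]
  have hR : ∀ T : Finset (Fin k), XL k X i Pd Ad Pe Ae (colPat k X i p T W) u =
      ∑ d ∈ rbox k X i, (if LinSys d Pd Ad u then (1 : ℝ) else 0) *
        ∑ e ∈ rbox k X i, (if PFree p e ∧ scaleAt p T e ∈ rbox k X i ∧ LinSys e Pe Ae u then
          W d (scaleAt p T e) else 0) := by
    intro T
    unfold XL
    refine Finset.sum_congr rfl fun d _ => ?_
    rw [Finset.mul_sum]
    refine Finset.sum_congr rfl fun e _ => ?_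
    rw [boole_mul_ite_zero]
    simp only [colPat]
    by_cases h1 : LinSys d Pd Ad u <;> by_cases h2 : LinSys e Pe Ae u <;>
      by_cases h3 : PFree p e ∧ scaleAt p T e ∈ rbox k X i <;> simp [h1, h2, h3]
  rw [hL]
  simp only [hR]
  have hmid : ∀ d ∈ rbox k X i, (if LinSys d Pd Ad u then (1 : ℝ) else 0) *
      ∑ e ∈ rbox k X i, (if LinSys e Pe Ae u then W d e else 0) =
      (if LinSys d Pd Ad u then (1 : ℝ) else 0) *
        ∑ T ∈ (Finset.univ : Finset (Fin k)).powerset,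
          (if ∀ j ∈ T, (p : ℤ) ∣ Pe j + Ae j * (u : ℤ) then (1 : ℝ) else 0) *
            ∑ e ∈ rbox k X i, (if PFree p e ∧ scaleAt p T e ∈ rbox k X i ∧ LinSys e Pe Ae u then
              W d (scaleAt p T e) else 0) := by
    intro d _
    rw [sum_rbox_linSys_eq_sum_powerset hp Pe Ae u (fun e => W d e) (fun e _ hne => hW d e hne)]
  rw [Finset.sum_congr rfl hmid]
  simp only [Finset.mul_sum]
  rw [Finset.sum_comm]
  refine Finset.sum_congr rfl fun T _ => Finset.sum_congr rfl fun d _ =>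
    Finset.sum_congr rfl fun e _ => ?_
  ring

open Classical in
/-- **Row decomposition**: `X_W(u) = Σ_S [∀ j ∈ S, p ∣ P^d_j + A^d_j u] X_{S ▹ W}(u)` for `W`
vanishing off squarefree `d`. [cite: Maynard2016LargeGaps, Lemma 7 (proof, before (6.33))] -/
theorem XL_eq_sum_rowPat {p : ℕ} (hp : p.Prime) {X : ℕ} {i : Fin k} (Pd Ad Pe Ae : Fin k → ℤ)
    {W : (Fin k → ℕ) → (Fin k → ℕ) → ℝ} (hW : ∀ d e, W d e ≠ 0 → ∀ j, Squarefree (d j)) (u : ℕ) :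
    XL k X i Pd Ad Pe Ae W u =
      ∑ S ∈ (Finset.univ : Finset (Fin k)).powerset,
        (if ∀ j ∈ S, (p : ℤ) ∣ Pd j + Ad j * (u : ℤ) then (1 : ℝ) else 0) *
          XL k X i Pd Ad Pe Ae (rowPat k X i p S W) u := by
  rw [XL_transpose, XL_eq_sum_colPat hp Pe Ae Pd Ad (W := fun e d => W d e)
    (fun e d hne => hW d e hne) u]
  refine Finset.sum_congr rfl fun S _ => ?_
  congr 1
  rw [XL_transpose]
  rfl

open Classical in
/-- **Pattern decomposition of `X_Λ`**: for a weight vanishing off squarefree coordinates and a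
prime `p`, for every `u`,
`X_Λ(u) = Σ_{S} Σ_{T} [∀ j ∈ S, p ∣ P^d_j + A^d_j u] [∀ l ∈ T, p ∣ P^e_l + A^e_l u] X_{Λ^{(S,T)}}(u)`.
[cite: Maynard2016LargeGaps, Lemma 7 (proof, before (6.33))] -/
theorem XL_eq_sum_patWt {p : ℕ} (hp : p.Prime) {X : ℕ} {i : Fin k} (Pd Ad Pe Ae : Fin k → ℤ)
    {Λ : (Fin k → ℕ) → (Fin k → ℕ) → ℝ}
    (hΛ : ∀ d e, Λ d e ≠ 0 → (∀ j, Squarefree (d j)) ∧ ∀ j, Squarefree (e j)) (u : ℕ) :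
    XL k X i Pd Ad Pe Ae Λ u =
      ∑ S ∈ (Finset.univ : Finset (Fin k)).powerset, ∑ T ∈ (Finset.univ : Finset (Fin k)).powerset,
        (if ∀ j ∈ S, (p : ℤ) ∣ Pd j + Ad j * (u : ℤ) then (1 : ℝ) else 0) *
        (if ∀ j ∈ T, (p : ℤ) ∣ Pe j + Ae j * (u : ℤ) then (1 : ℝ) else 0) *
        XL k X i Pd Ad Pe Ae (patWt k X i p S T Λ) u := by
  rw [XL_eq_sum_colPat hp Pd Ad Pe Ae (fun d e h => (hΛ d e h).2) u]
  have hcol : ∀ T : Finset (Fin k), ∀ d e, colPat k X i p T Λ d e ≠ 0 → ∀ j, Squarefree (d j) := by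
    intro T d e h
    simp only [colPat] at h
    by_cases hc : PFree p e ∧ scaleAt p T e ∈ rbox k X i
    · rw [if_pos hc] at h
      exact (hΛ _ _ h).1
    · rw [if_neg hc] at h
      exact absurd rfl h
  have hT : ∀ T ∈ (Finset.univ : Finset (Fin k)).powerset,
      (if ∀ j ∈ T, (p : ℤ) ∣ Pe j + Ae j * (u : ℤ) then (1 : ℝ) else 0) *
        XL k X i Pd Ad Pe Ae (colPat k X i p T Λ) u =
      (if ∀ j ∈ T, (p : ℤ) ∣ Pe j + Ae j * (u : ℤ) then (1 : ℝ) else 0) *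
        ∑ S ∈ (Finset.univ : Finset (Fin k)).powerset,
          (if ∀ j ∈ S, (p : ℤ) ∣ Pd j + Ad j * (u : ℤ) then (1 : ℝ) else 0) *
            XL k X i Pd Ad Pe Ae (patWt k X i p S T Λ) u := by
    intro T _
    rw [XL_eq_sum_rowPat hp Pd Ad Pe Ae (hcol T) u]
    simp only [rowPat_colPat]
  rw [Finset.sum_congr rfl hT]
  simp only [Finset.mul_sum]
  rw [Finset.sum_comm]
  refine Finset.sum_congr rfl fun S _ => Finset.sum_congr rfl fun T _ => ?_
  ring

open Classical in
/-- **Cauchy–Schwarz over the patterns**: `X_Λ(u)² ≤ 4^k Σ_{S,T} X_{Λ^{(S,T)}}(u)²`.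
[cite: Maynard2016LargeGaps, Lemma 7 (proof, before (6.33))] -/
theorem XL_sq_le_sum_patWt_sq {p : ℕ} (hp : p.Prime) {X : ℕ} {i : Fin k} (Pd Ad Pe Ae : Fin k → ℤ)
    {Λ : (Fin k → ℕ) → (Fin k → ℕ) → ℝ}
    (hΛ : ∀ d e, Λ d e ≠ 0 → (∀ j, Squarefree (d j)) ∧ ∀ j, Squarefree (e j)) (u : ℕ) :
    XL k X i Pd Ad Pe Ae Λ u ^ 2 ≤
      (4 : ℝ) ^ k * ∑ S ∈ (Finset.univ : Finset (Fin k)).powerset,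
        ∑ T ∈ (Finset.univ : Finset (Fin k)).powerset,
          XL k X i Pd Ad Pe Ae (patWt k X i p S T Λ) u ^ 2 := by
  rw [XL_eq_sum_patWt hp Pd Ad Pe Ae hΛ u, ← Finset.sum_product']
  refine sq_sum_le_card_mul_sum_sq.trans ?_
  rw [Finset.card_product, Finset.card_powerset, Finset.card_univ, Fintype.card_fin,
    Finset.sum_product]
  have h4 : (((2 ^ k * 2 ^ k : ℕ)) : ℝ) = (4 : ℝ) ^ k := by
    rw [← mul_pow]; push_cast; norm_num
  rw [h4]
  refine mul_le_mul_of_nonneg_left (Finset.sum_le_sum fun S _ => Finset.sum_le_sum fun T _ => ?_)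
    (by positivity)
  have hc : ∀ (A B : Prop) [Decidable A] [Decidable B] (z : ℝ),
      ((if A then (1 : ℝ) else 0) * (if B then (1 : ℝ) else 0) * z) ^ 2 ≤ z ^ 2 := by
    intro A B _ _ z
    by_cases hA : A <;> by_cases hB : B <;> simp [hA, hB, sq_nonneg]
  exact hc _ _ _

/-! ### Periodicity and the Chinese remainder theorem -/

/-- `LinSys` only depends on `u` modulo a common multiple of the moduli. [cite: Maynard2016LargeGaps, Lemma 7 (proof, display (6.27))] -/
theorem linSys_iff_of_modEq {d : Fin k → ℕ} {P A : Fin k → ℤ} {N u v : ℕ} (hN : ∀ j, d j ∣ N)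
    (huv : u ≡ v [MOD N]) : LinSys d P A u ↔ LinSys d P A v := by
  have key : ∀ j, (d j : ℤ) ∣ (P j + A j * (u : ℤ)) - (P j + A j * (v : ℤ)) := by
    intro j
    have h1 : (d j : ℤ) ∣ (u : ℤ) - (v : ℤ) :=
      (Int.natCast_dvd_natCast.2 (hN j)).trans (Nat.ModEq.dvd huv.symm)
    have : (P j + A j * (u : ℤ)) - (P j + A j * (v : ℤ)) = A j * ((u : ℤ) - v) := by ring
    rw [this]
    exact h1.mul_left _
  constructor
  · intro h j
    exact (dvd_sub_right (h j)).1 (key j)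
  · intro h j
    exact (dvd_sub_left (h j)).1 (key j)

/-- **Periodicity**: if every pair in the support of `W` (inside `rbox²`) has all moduli dividing
`N`, then `X_W(u)` depends on `u mod N` only. [cite: Maynard2016LargeGaps, Lemma 7 (proof, display (6.32))] -/
theorem XL_congr_of_modEq {X : ℕ} {i : Fin k} (Pd Ad Pe Ae : Fin k → ℤ)
    {W : (Fin k → ℕ) → (Fin k → ℕ) → ℝ} {N u v : ℕ}
    (hW : ∀ d ∈ rbox k X i, ∀ e ∈ rbox k X i, W d e ≠ 0 → (∀ j, d j ∣ N) ∧ ∀ j, e j ∣ N)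
    (huv : u ≡ v [MOD N]) : XL k X i Pd Ad Pe Ae W u = XL k X i Pd Ad Pe Ae W v := by
  unfold XL
  refine Finset.sum_congr rfl fun d hd => Finset.sum_congr rfl fun e he => ?_
  by_cases h0 : W d e = 0
  · simp [h0]
  · obtain ⟨hdN, heN⟩ := hW d hd e he h0
    have h1 := linSys_iff_of_modEq (P := Pd) (A := Ad) hdN huv
    have h2 := linSys_iff_of_modEq (P := Pe) (A := Ae) heN huv
    by_cases hs : LinSys d Pd Ad u ∧ LinSys e Pe Ae u
    · rw [if_pos hs, if_pos (show LinSys d Pd Ad v ∧ LinSys e Pe Ae v from ⟨h1.1 hs.1, h2.1 hs.2⟩)]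
    · rw [if_neg hs, if_neg (show ¬ (LinSys d Pd Ad v ∧ LinSys e Pe Ae v) from
        fun h' => hs ⟨h1.2 h'.1, h2.2 h'.2⟩)]

/-- **CRT, class version**: for `(p, R') = 1`, `c` a unit mod `p` and an `R'`-periodic `F`,
`Σ_{u ∈ U_{pR'}, u ≡ c (p)} F(u) = Σ_{b ∈ U_{R'}} F(b)`. [cite: Maynard2016LargeGaps, Lemma 7 (proof, before (6.33))] -/
theorem sum_unitsR_filter_mod_eq_sum {p R' : ℕ} (hp0 : p ≠ 0) (hR' : R' ≠ 0)
    (hpR' : Nat.Coprime p R') {c : ℕ} (hc : c ∈ unitsR p) (F : ℕ → ℝ)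
    (hF : ∀ u, F u = F (u % R')) :
    ∑ u ∈ (unitsR (p * R')).filter (fun u => u % p = c), F u = ∑ b ∈ unitsR R', F b := by
  rw [Finset.sum_filter]
  have h := sum_unitsR_mul_mod_eq (α := ℝ) hp0 hR' hpR' (fun a => if a = c then (1 : ℝ) else 0) F
  simp only [Finset.sum_ite_eq' (unitsR p) c, if_pos hc, one_mul] at h
  rw [← h]
  refine Finset.sum_congr rfl fun u _ => ?_
  rw [← hF u]
  by_cases huc : u % p = c <;> simp [huc]

/-- **CRT, weighted version**: `Σ_{u ∈ U_{pR'}} g(u mod p) F(u) = (Σ_{a ∈ U_p} g a) Σ_{b ∈ U_{R'}} F(b)`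
for an `R'`-periodic `F`. [cite: Maynard2016LargeGaps, Lemma 7 (proof, before (6.33))] -/
theorem sum_unitsR_mul_periodic_eq {p R' : ℕ} (hp0 : p ≠ 0) (hR' : R' ≠ 0)
    (hpR' : Nat.Coprime p R') (g F : ℕ → ℝ) (hF : ∀ u, F u = F (u % R')) :
    ∑ u ∈ unitsR (p * R'), g (u % p) * F u = (∑ a ∈ unitsR p, g a) * ∑ b ∈ unitsR R', F b := by
  rw [← sum_unitsR_mul_mod_eq (α := ℝ) hp0 hR' hpR' g F]
  exact Finset.sum_congr rfl fun u _ => by rw [← hF u]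

/-! ### Bad classes and the good-class identity -/

open Classical in
/-- The root classes modulo `p` of the forms `P_j + A_j a` (`d`- and `e`-side), `j ≠ i`.
[cite: Maynard2016LargeGaps, Lemma 7 (proof, before (6.33))] -/
def badClasses (p : ℕ) (i : Fin k) (Pd Ad Pe Ae : Fin k → ℤ) : Finset ℕ :=
  (Finset.range p).filter (fun a => ∃ j : Fin k, j ≠ i ∧
    ((p : ℤ) ∣ Pd j + Ad j * (a : ℤ) ∨ (p : ℤ) ∣ Pe j + Ae j * (a : ℤ)))

open Classical in
/-- A linear form with invertible slope has at most one root modulo a prime. [cite: Maynard2016LargeGaps, Lemma 7 (proof, before (6.33))] -/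
theorem card_filter_range_dvd_le_one {p : ℕ} (hp : p.Prime) {P A : ℤ} (hA : ¬ (p : ℤ) ∣ A) :
    ((Finset.range p).filter (fun a : ℕ => (p : ℤ) ∣ P + A * (a : ℤ))).card ≤ 1 := by
  refine Finset.card_le_one.2 fun a ha b hb => ?_
  simp only [Finset.mem_filter, Finset.mem_range] at ha hb
  have h1 : (p : ℤ) ∣ A * ((a : ℤ) - b) := by
    have : A * ((a : ℤ) - b) = (P + A * a) - (P + A * b) := by ring
    rw [this]
    exact dvd_sub ha.2 hb.2
  have hpZ : Prime (p : ℤ) := Nat.prime_iff_prime_int.1 hp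
  rcases hpZ.dvd_or_dvd h1 with h | h
  · exact absurd h hA
  · have h0 : (a : ℤ) - b = 0 := by
      refine Int.eq_zero_of_dvd_of_natAbs_lt_natAbs h ?_
      rw [Int.natAbs_natCast]
      omega
    omega

/-- `#badClasses ≤ 2(k−1)` when the slopes `A^d_j, A^e_j` (`j ≠ i`) are invertible mod `p`.
[cite: Maynard2016LargeGaps, Lemma 7 (proof, before (6.33))] -/
theorem card_badClasses_le {p : ℕ} (hp : p.Prime) {i : Fin k} {Pd Ad Pe Ae : Fin k → ℤ}
    (hAd : ∀ j, j ≠ i → ¬ (p : ℤ) ∣ Ad j) (hAe : ∀ j, j ≠ i → ¬ (p : ℤ) ∣ Ae j) :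
    (badClasses p i Pd Ad Pe Ae).card ≤ 2 * (k - 1) := by
  classical
  have hsub : badClasses p i Pd Ad Pe Ae ⊆ (Finset.univ.erase i).biUnion (fun j =>
      (Finset.range p).filter (fun a : ℕ => (p : ℤ) ∣ Pd j + Ad j * (a : ℤ)) ∪
        (Finset.range p).filter (fun a : ℕ => (p : ℤ) ∣ Pe j + Ae j * (a : ℤ))) := by
    intro a ha
    simp only [badClasses, Finset.mem_filter, Finset.mem_range] at ha
    obtain ⟨hap, j, hji, hj⟩ := ha
    refine Finset.mem_biUnion.2 ⟨j, Finset.mem_erase.2 ⟨hji, Finset.mem_univ _⟩, ?_⟩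
    rcases hj with h | h
    · exact Finset.mem_union_left _ (Finset.mem_filter.2 ⟨Finset.mem_range.2 hap, h⟩)
    · exact Finset.mem_union_right _ (Finset.mem_filter.2 ⟨Finset.mem_range.2 hap, h⟩)
  refine (Finset.card_le_card hsub).trans (Finset.card_biUnion_le.trans ?_)
  have h2 : ∀ j ∈ Finset.univ.erase i,
      ((Finset.range p).filter (fun a : ℕ => (p : ℤ) ∣ Pd j + Ad j * (a : ℤ)) ∪
        (Finset.range p).filter (fun a : ℕ => (p : ℤ) ∣ Pe j + Ae j * (a : ℤ))).card ≤ 2 := by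
    intro j hj
    have hji := (Finset.mem_erase.1 hj).1
    exact (Finset.card_union_le _ _).trans (add_le_add (card_filter_range_dvd_le_one hp (hAd j hji))
      (card_filter_range_dvd_le_one hp (hAe j hji)))
  refine (Finset.sum_le_sum h2).trans ?_
  rw [Finset.sum_const, Finset.card_erase_of_mem (Finset.mem_univ i), Finset.card_univ,
    Fintype.card_fin, smul_eq_mul, mul_comm]

/-- Reduction of a root to its class mod `p`. [cite: Maynard2016LargeGaps, Lemma 7 (proof, before (6.33))] -/
theorem dvd_shift_mod {p : ℕ} {P A : ℤ} {u : ℕ} (h : (p : ℤ) ∣ P + A * (u : ℤ)) :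
    (p : ℤ) ∣ P + A * ((u % p : ℕ) : ℤ) := by
  have hu : (u : ℤ) = ((u % p : ℕ) : ℤ) + (p : ℤ) * ((u / p : ℕ) : ℤ) := by
    exact_mod_cast (Nat.mod_add_div u p).symm
  have : P + A * (u : ℤ) - (P + A * ((u % p : ℕ) : ℤ)) = (p : ℤ) * (A * ((u / p : ℕ) : ℤ)) := by
    rw [hu]; ring
  exact (dvd_sub_right h).1 (this ▸ dvd_mul_right _ _)

/-- If a vector `d ∈ rbox` solving its system has `p ∣ d_j`, then `j ≠ i` and `u mod p` is a root
class. [cite: Maynard2016LargeGaps, Lemma 7 (proof, before (6.33))] -/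
theorem root_of_dvd_coord {p : ℕ} (hp : p.Prime) {X : ℕ} {i : Fin k} {d : Fin k → ℕ}
    (hd : d ∈ rbox k X i) {P A : Fin k → ℤ} {u : ℕ} (hsys : LinSys d P A u) {j : Fin k}
    (hpd : p ∣ d j) : j ≠ i ∧ (p : ℤ) ∣ P j + A j * ((u % p : ℕ) : ℤ) := by
  refine ⟨?_, dvd_shift_mod ((Int.natCast_dvd_natCast.2 hpd).trans (hsys j))⟩
  rintro rfl
  rw [(mem_rbox.1 hd).2] at hpd
  exact hp.one_lt.ne' (Nat.dvd_one.1 hpd)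

/-- **Good classes**: if `u mod p` is not a root class, only `p`-free pairs contribute to `X_W(u)`:
`X_W(u) = X_{W^{pf}}(u)`. [cite: Maynard2016LargeGaps, Lemma 7 (proof, before (6.33))] -/
theorem XL_eq_XL_pfPart_of_good {p : ℕ} (hp : p.Prime) {X : ℕ} {i : Fin k}
    (Pd Ad Pe Ae : Fin k → ℤ) {u : ℕ} (hu : u % p ∉ badClasses p i Pd Ad Pe Ae)
    (W : (Fin k → ℕ) → (Fin k → ℕ) → ℝ) :
    XL k X i Pd Ad Pe Ae W u = XL k X i Pd Ad Pe Ae (pfPart p W) u := by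
  classical
  have hup : u % p < p := Nat.mod_lt _ hp.pos
  unfold XL
  refine Finset.sum_congr rfl fun d hd => Finset.sum_congr rfl fun e he => ?_
  simp only [pfPart]
  by_cases hs : LinSys d Pd Ad u ∧ LinSys e Pe Ae u
  · have hpf : PFree p d ∧ PFree p e := by
      constructor
      · intro j hj
        obtain ⟨hji, hr⟩ := root_of_dvd_coord hp hd hs.1 hj
        exact hu (Finset.mem_filter.2 ⟨Finset.mem_range.2 hup, j, hji, Or.inl hr⟩)
      · intro j hj
        obtain ⟨hji, hr⟩ := root_of_dvd_coord hp he hs.2 hj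
        exact hu (Finset.mem_filter.2 ⟨Finset.mem_range.2 hup, j, hji, Or.inr hr⟩)
    rw [if_pos hs, if_pos hs, if_pos hpf]
  · rw [if_neg hs, if_neg hs]

/-- **Averaging over the good classes**: for `p − 1 ≥ 4(k−1)`, `(p, R') = 1` and `X_{W^{pf}}`
`R'`-periodic, `((p−1)/2) Σ_{b ∈ U_{R'}} X_{W^{pf}}(b)² ≤ Σ_{u ∈ U_{pR'}} X_W(u)²`.
[cite: Maynard2016LargeGaps, Lemma 7 (proof, before (6.33))] -/
theorem sum_unitsR_XL_pfPart_sq_le {p : ℕ} (hp : p.Prime) {X : ℕ} {i : Fin k}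
    (Pd Ad Pe Ae : Fin k → ℤ) (hAd : ∀ j, j ≠ i → ¬ (p : ℤ) ∣ Ad j)
    (hAe : ∀ j, j ≠ i → ¬ (p : ℤ) ∣ Ae j) (hpk : 4 * (k - 1) ≤ p - 1)
    {R' : ℕ} (hR' : R' ≠ 0) (hpR' : Nat.Coprime p R') (W : (Fin k → ℕ) → (Fin k → ℕ) → ℝ)
    (hper : ∀ u, XL k X i Pd Ad Pe Ae (pfPart p W) u = XL k X i Pd Ad Pe Ae (pfPart p W) (u % R')) :
    ((p - 1 : ℝ) / 2) * ∑ b ∈ unitsR R', XL k X i Pd Ad Pe Ae (pfPart p W) b ^ 2 ≤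
      ∑ u ∈ unitsR (p * R'), XL k X i Pd Ad Pe Ae W u ^ 2 := by
  classical
  have h1 : ∑ u ∈ unitsR (p * R'),
      (if u % p ∉ badClasses p i Pd Ad Pe Ae then (1 : ℝ) else 0) *
        XL k X i Pd Ad Pe Ae (pfPart p W) u ^ 2 ≤
      ∑ u ∈ unitsR (p * R'), XL k X i Pd Ad Pe Ae W u ^ 2 := by
    refine Finset.sum_le_sum fun u _ => ?_
    by_cases hb : u % p ∈ badClasses p i Pd Ad Pe Ae
    · rw [if_neg (not_not_intro hb), zero_mul]; positivity
    · rw [if_pos hb, one_mul, XL_eq_XL_pfPart_of_good hp Pd Ad Pe Ae hb W]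
  rw [sum_unitsR_mul_periodic_eq hp.ne_zero hR' hpR'
    (fun a => if a ∉ badClasses p i Pd Ad Pe Ae then (1 : ℝ) else 0)
    (fun u => XL k X i Pd Ad Pe Ae (pfPart p W) u ^ 2) (fun u => by rw [← hper u])] at h1
  -- the number of good unit classes is at least `(p−1)/2`
  have h3 : ((p - 1 : ℝ) / 2) ≤
      ∑ a ∈ unitsR p, (if a ∉ badClasses p i Pd Ad Pe Ae then (1 : ℝ) else 0) := by
    rw [← Finset.natCast_card_filter]
    have hsd : (unitsR p).filter (fun a => a ∉ badClasses p i Pd Ad Pe Ae) =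
        unitsR p \ badClasses p i Pd Ad Pe Ae := by
      ext a; simp [Finset.mem_sdiff]
    have hcard : (unitsR p).card - (badClasses p i Pd Ad Pe Ae).card ≤
        ((unitsR p).filter (fun a => a ∉ badClasses p i Pd Ad Pe Ae)).card := by
      rw [hsd]; exact Finset.le_card_sdiff _ _
    rw [card_unitsR, Nat.totient_prime hp] at hcard
    have hB : (badClasses p i Pd Ad Pe Ae).card ≤ 2 * (k - 1) := card_badClasses_le hp hAd hAe
    have hnat : p - 1 ≤ 2 * ((unitsR p).filter (fun a => a ∉ badClasses p i Pd Ad Pe Ae)).card := by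
      omega
    have hcast : ((p : ℝ) - 1) = ((p - 1 : ℕ) : ℝ) := by
      rw [Nat.cast_sub hp.one_le, Nat.cast_one]
    have hreal : (((p - 1 : ℕ) : ℝ)) ≤
        2 * (((unitsR p).filter (fun a => a ∉ badClasses p i Pd Ad Pe Ae)).card : ℝ) := by
      exact_mod_cast hnat
    rw [hcast]
    linarith
  have hF : 0 ≤ ∑ b ∈ unitsR R', XL k X i Pd Ad Pe Ae (pfPart p W) b ^ 2 :=
    Finset.sum_nonneg fun b _ => sq_nonneg _
  exact (mul_le_mul_of_nonneg_right h3 hF).trans h1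

/-! ### The class bound -/

/-- On `rbox`, a `p`-free pattern weight of a weight with squarefree support has all its moduli
dividing any `R'` divisible by every `p`-free squarefree `n ≤ X`.
[cite: Maynard2016LargeGaps, Lemma 7 (proof, before (6.33))] -/
theorem patWt_moduli_dvd {p : ℕ} {X : ℕ} {i : Fin k} (S T : Finset (Fin k))
    {W : (Fin k → ℕ) → (Fin k → ℕ) → ℝ}
    (hW : ∀ d e, W d e ≠ 0 → (∀ j, Squarefree (d j)) ∧ ∀ j, Squarefree (e j))
    {R' : ℕ} (hdiv : ∀ n, Squarefree n → n ≤ X → ¬ p ∣ n → n ∣ R') :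
    ∀ d ∈ rbox k X i, ∀ e ∈ rbox k X i, patWt k X i p S T W d e ≠ 0 →
      (∀ j, d j ∣ R') ∧ ∀ j, e j ∣ R' := by
  classical
  intro d hd e he h
  simp only [patWt] at h
  by_cases hc : (PFree p d ∧ scaleAt p S d ∈ rbox k X i) ∧ (PFree p e ∧ scaleAt p T e ∈ rbox k X i)
  · rw [if_pos hc] at h
    obtain ⟨hsd, hse⟩ := hW _ _ h
    have hbd := fun j => Finset.mem_Icc.1 (Fintype.mem_piFinset.1 (mem_rbox.1 hd).1 j)
    have hbe := fun j => Finset.mem_Icc.1 (Fintype.mem_piFinset.1 (mem_rbox.1 he).1 j)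
    exact ⟨fun j => hdiv _ ((hsd j).squarefree_of_dvd (dvd_scaleAt p S d j)) (hbd j).2 (hc.1.1 j),
      fun j => hdiv _ ((hse j).squarefree_of_dvd (dvd_scaleAt p T e j)) (hbe j).2 (hc.2.1 j)⟩
  · rw [if_neg hc] at h
    exact absurd rfl h

/-- **The class bound** (the content of "restricting `q` to a residue class mod `p` costs a factor
`≪_k 1/p`"): for a prime `p` with `p − 1 ≥ 4(k−1)`, `(p, R') = 1`, `R'` divisible by every
`p`-free squarefree `n ≤ X`, slopes `A^d_j, A^e_j` (`j ≠ i`) invertible mod `p`, a unit class `c`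
mod `p`, and a weight `Λ` vanishing off squarefree coordinates,
`Σ_{u ∈ U_{pR'}, u ≡ c (p)} X_Λ(u)² ≤ (2·4^k/(p−1)) Σ_{S,T} Σ_{u ∈ U_{pR'}} X_{Λ^{[S,T]}}(u)²`.
[cite: Maynard2016LargeGaps, Lemma 7 (proof, before (6.33))] -/
theorem sum_filter_mod_XL_sq_le {p : ℕ} (hp : p.Prime) {X : ℕ} {i : Fin k}
    (Pd Ad Pe Ae : Fin k → ℤ) (hAd : ∀ j, j ≠ i → ¬ (p : ℤ) ∣ Ad j)
    (hAe : ∀ j, j ≠ i → ¬ (p : ℤ) ∣ Ae j) (hpk : 4 * (k - 1) ≤ p - 1)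
    {R' : ℕ} (hR' : R' ≠ 0) (hpR' : Nat.Coprime p R')
    (hdiv : ∀ n, Squarefree n → n ≤ X → ¬ p ∣ n → n ∣ R') {c : ℕ} (hc : c ∈ unitsR p)
    {Λ : (Fin k → ℕ) → (Fin k → ℕ) → ℝ}
    (hΛ : ∀ d e, Λ d e ≠ 0 → (∀ j, Squarefree (d j)) ∧ ∀ j, Squarefree (e j)) :
    ∑ u ∈ (unitsR (p * R')).filter (fun u => u % p = c), XL k X i Pd Ad Pe Ae Λ u ^ 2 ≤
      (2 * (4 : ℝ) ^ k / (p - 1 : ℝ)) *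
        ∑ S ∈ (Finset.univ : Finset (Fin k)).powerset, ∑ T ∈ (Finset.univ : Finset (Fin k)).powerset,
          ∑ u ∈ unitsR (p * R'), XL k X i Pd Ad Pe Ae (fullPatWt k X i p S T Λ) u ^ 2 := by
  classical
  have hp1 : (0 : ℝ) < (p : ℝ) - 1 := by
    have : (2 : ℝ) ≤ p := by exact_mod_cast hp.two_le
    linarith
  -- periodicity of the `p`-free pattern variables
  have hper : ∀ (S T : Finset (Fin k)) (u : ℕ), XL k X i Pd Ad Pe Ae (patWt k X i p S T Λ) u =
      XL k X i Pd Ad Pe Ae (patWt k X i p S T Λ) (u % R') := fun S T u =>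
    XL_congr_of_modEq Pd Ad Pe Ae (patWt_moduli_dvd S T hΛ hdiv) (Nat.mod_modEq u R').symm
  -- Step 1: Cauchy–Schwarz termwise, then exchange the sums
  have h1 : ∑ u ∈ (unitsR (p * R')).filter (fun u => u % p = c), XL k X i Pd Ad Pe Ae Λ u ^ 2 ≤
      (4 : ℝ) ^ k * ∑ S ∈ (Finset.univ : Finset (Fin k)).powerset,
        ∑ T ∈ (Finset.univ : Finset (Fin k)).powerset,
          ∑ u ∈ (unitsR (p * R')).filter (fun u => u % p = c),
            XL k X i Pd Ad Pe Ae (patWt k X i p S T Λ) u ^ 2 := by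
    refine (Finset.sum_le_sum fun u _ => XL_sq_le_sum_patWt_sq hp Pd Ad Pe Ae hΛ u).trans
      (le_of_eq ?_)
    rw [← Finset.mul_sum]
    congr 1
    exact Finset.sum_comm.trans (Finset.sum_congr rfl fun S _ => Finset.sum_comm)
  -- Step 2: each class sum of a `p`-free pattern is a full sum modulo `R'` (CRT), which the
  -- good-class average bounds by `2/(p−1)` times the full sum of the FULL pattern weight
  have h2 : ∀ S T : Finset (Fin k),
      ∑ u ∈ (unitsR (p * R')).filter (fun u => u % p = c),
          XL k X i Pd Ad Pe Ae (patWt k X i p S T Λ) u ^ 2 ≤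
        (2 / ((p : ℝ) - 1)) * ∑ u ∈ unitsR (p * R'), XL k X i Pd Ad Pe Ae (fullPatWt k X i p S T Λ) u ^ 2 := by
    intro S T
    rw [sum_unitsR_filter_mod_eq_sum hp.ne_zero hR' hpR' hc
      (fun u => XL k X i Pd Ad Pe Ae (patWt k X i p S T Λ) u ^ 2) (fun u => by rw [← hper S T u])]
    have h3 := sum_unitsR_XL_pfPart_sq_le hp Pd Ad Pe Ae hAd hAe hpk hR' hpR'
      (fullPatWt k X i p S T Λ) (fun u => by rw [← patWt_eq_pfPart_fullPatWt]; exact hper S T u)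
    rw [← patWt_eq_pfPart_fullPatWt] at h3
    rw [div_mul_eq_mul_div, le_div_iff₀ hp1]
    calc (∑ b ∈ unitsR R', XL k X i Pd Ad Pe Ae (patWt k X i p S T Λ) b ^ 2) * ((p : ℝ) - 1)
        = 2 * (((p : ℝ) - 1) / 2 *
            ∑ b ∈ unitsR R', XL k X i Pd Ad Pe Ae (patWt k X i p S T Λ) b ^ 2) := by ring
      _ ≤ 2 * ∑ u ∈ unitsR (p * R'), XL k X i Pd Ad Pe Ae (fullPatWt k X i p S T Λ) u ^ 2 := by
          linarith [h3]
  refine h1.trans ?_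
  have h4 : (4 : ℝ) ^ k * ∑ S ∈ (Finset.univ : Finset (Fin k)).powerset,
        ∑ T ∈ (Finset.univ : Finset (Fin k)).powerset,
          ∑ u ∈ (unitsR (p * R')).filter (fun u => u % p = c),
            XL k X i Pd Ad Pe Ae (patWt k X i p S T Λ) u ^ 2 ≤
      (4 : ℝ) ^ k * ∑ S ∈ (Finset.univ : Finset (Fin k)).powerset,
        ∑ T ∈ (Finset.univ : Finset (Fin k)).powerset,
          (2 / ((p : ℝ) - 1)) *
            ∑ u ∈ unitsR (p * R'), XL k X i Pd Ad Pe Ae (fullPatWt k X i p S T Λ) u ^ 2 :=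
    mul_le_mul_of_nonneg_left (Finset.sum_le_sum fun S _ => Finset.sum_le_sum fun T _ => h2 S T)
      (by positivity)
  refine h4.trans (le_of_eq ?_)
  rw [Finset.mul_sum, Finset.mul_sum]
  refine Finset.sum_congr rfl fun S _ => ?_
  rw [Finset.mul_sum, Finset.mul_sum]
  refine Finset.sum_congr rfl fun T _ => ?_
  ring

/-! ### Back to the Lemma 7 model -/

/-- The Lemma 7 slopes are invertible modulo a prime `p ∤ m` not dividing any `h_j − h_i`, `j ≠ i`.
[cite: Maynard2016LargeGaps, Lemma 7 (proof, before (6.33))] -/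
theorem sysA_not_dvd {x m : ℕ} {i : Fin k} {p : ℕ} (hp : p.Prime) (hpm : ¬ p ∣ m)
    (hph : ∀ j, j ≠ i → ¬ (p : ℤ) ∣ (hTuple k x j : ℤ) - hTuple k x i) :
    (∀ j, j ≠ i → ¬ (p : ℤ) ∣ sysA k x i m (Sum.inl j)) ∧
      ∀ j, j ≠ i → ¬ (p : ℤ) ∣ sysA k x i m (Sum.inr j) := by
  refine ⟨fun j hj => hph j hj, fun j hj h => ?_⟩
  have hpZ : Prime (p : ℤ) := Nat.prime_iff_prime_int.1 hp
  change (p : ℤ) ∣ (m : ℤ) * ((hTuple k x j : ℤ) - hTuple k x i) at h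
  rcases hpZ.dvd_or_dvd h with h' | h'
  · exact hpm (Int.natCast_dvd_natCast.1 h')
  · exact hph j hj h'

/-- **The class bound in the Lemma 7 model**: for an admissible weight `Λ`, `R = p R'` squarefree
with every squarefree `n ≤ x` dividing `R`, `p` prime with `p − 1 ≥ 4(k−1)`, `p ∤ m`,
`p ∤ h_j − h_i` (`j ≠ i`) and a unit class `c` mod `p`,
`Σ_{u ∈ U_R, u ≡ c (p)} X_Λ(u)² ≤ (2·4^k/(p−1)) · φ(R) · Σ_{S,T} Q(Λ^{[S,T]}, Λ^{[S,T]})`.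
[cite: Maynard2016LargeGaps, Lemma 7 (proof, displays (6.32)–(6.33))] -/
theorem sum_filter_mod_Xwt_sq_le_totient_mul_Qform {x m p₀ : ℕ} (hp₀ : p₀.Prime) (hm : 1 ≤ m)
    {i : Fin k} (hacop : ∀ j, j ≠ i → IsCoprime ((m : ℤ) * p₀ - 1) ((hTuple k x j : ℤ) - hTuple k x i))
    {Λ : (Fin k → ℕ) → (Fin k → ℕ) → ℝ} (hΛ : AdmWt k m p₀ Λ)
    {p : ℕ} (hp : p.Prime) (hpk : 4 * (k - 1) ≤ p - 1) (hpm : ¬ p ∣ m)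
    (hph : ∀ j, j ≠ i → ¬ (p : ℤ) ∣ (hTuple k x j : ℤ) - hTuple k x i)
    {R' : ℕ} (hR : Squarefree (p * R')) (hxR : ∀ n, Squarefree n → n ≤ x → n ∣ p * R')
    {c : ℕ} (hc : c ∈ unitsR p) :
    ∑ u ∈ (unitsR (p * R')).filter (fun u => u % p = c), Xwt k x m p₀ i Λ u ^ 2 ≤
      (2 * (4 : ℝ) ^ k / (p - 1 : ℝ)) * (Nat.totient (p * R') : ℝ) *
        ∑ S ∈ (Finset.univ : Finset (Fin k)).powerset, ∑ T ∈ (Finset.univ : Finset (Fin k)).powerset,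
          Qform k x m p₀ i (fullPatWt k x i p S T Λ) (fullPatWt k x i p S T Λ) := by
  have hR' : R' ≠ 0 := fun h => by rw [h, mul_zero] at hR; exact not_squarefree_zero hR
  have hpR' : Nat.Coprime p R' := Nat.coprime_of_squarefree_mul hR
  have hdiv : ∀ n, Squarefree n → n ≤ x → ¬ p ∣ n → n ∣ R' := by
    intro n hn hnx hpn
    exact ((Nat.Prime.coprime_iff_not_dvd hp).2 hpn).symm.dvd_of_dvd_mul_left (hxR n hn hnx)
  obtain ⟨hAd, hAe⟩ := sysA_not_dvd (k := k) (x := x) hp hpm hph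
  have hΛsq : ∀ d e, Λ d e ≠ 0 → (∀ j, Squarefree (d j)) ∧ ∀ j, Squarefree (e j) :=
    fun d e h => ⟨(hΛ d e h).1, (hΛ d e h).2.1⟩
  have h1 := sum_filter_mod_XL_sq_le hp (X := x) (fun j => sysP k m p₀ (Sum.inl j))
    (fun j => sysA k x i m (Sum.inl j)) (fun j => sysP k m p₀ (Sum.inr j))
    (fun j => sysA k x i m (Sum.inr j)) hAd hAe hpk hR' hpR' hdiv hc hΛsq
  have e : ∀ (W : (Fin k → ℕ) → (Fin k → ℕ) → ℝ) (u : ℕ),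
      XL k x i (fun j => sysP k m p₀ (Sum.inl j)) (fun j => sysA k x i m (Sum.inl j))
        (fun j => sysP k m p₀ (Sum.inr j)) (fun j => sysA k x i m (Sum.inr j)) W u =
      Xwt k x m p₀ i W u := fun W u => (Xwt_eq_XL W u).symm
  simp only [e] at h1
  refine h1.trans (le_of_eq ?_)
  rw [mul_assoc]
  congr 1
  rw [Finset.mul_sum]
  refine Finset.sum_congr rfl fun S _ => ?_
  rw [Finset.mul_sum]
  refine Finset.sum_congr rfl fun T _ => ?_
  rw [mul_comm (Nat.totient (p * R') : ℝ), Qform_mul_totient_eq_sum_unitsR hp₀ hm hacop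
    (hΛ.fullPatWt hp S T) (hΛ.fullPatWt hp S T) hR hxR]
  exact Finset.sum_congr rfl fun u _ => by ring

end Maynard2016

end Literature.NumberTheory.Sieve
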